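import Literature.AlgebraicGeometry.AbelianSchemes.SerreTensorQuasiInverse
import Literature.AlgebraicGeometry.AbelianSchemes.AbelianSchemeOverQuasiInverseIsogeny
import HarnessLib

/-!
# `A ⊗_𝒪 φ` is an isogeny for a module map `φ : 𝔞 → 𝔞′` with a quasi-inverse up to an integer `N ≠ 0`

Topic `AlgebraicGeometry/AbelianSchemes`, namespace `Literature.AlgebraicGeometry.AbelianSchemes.AbelianSchemeOver` (THEOREMS ONLY; no
definition, no named fact, no `sorry`, no `instance`, no notation; any base `S`, any characteristic).  Cell `hodgecm-mathlib`, F0/P6 «MOD»,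
P6a organ (g2) FILE 15 = ★ FILE 13 `SerreTensorQuasiInverse` (formal half) + ★ FILE 14 `AbelianSchemeOverQuasiInverseIsogeny` (geometric
half); `--supports stmt-HodgeConjecture-24832`, count-neutral.  HC_CM is proved only modulo the 2 remaining named inputs (hLiu418, h413)
until rung 0 closes; this file discharges none of them.

## Mathematics

Let `𝔞 = E·𝒪ⁿ`, `𝔞′ = E′·𝒪ᵐ` be presented finite projective `𝒪`-modules and `P`, `Q` intertwiners (`E′P = PE`, `EQ = QE′`) with
`QP = N·E`, `PQ = N·E′` for an integer `N ≠ 0` — e.g. the matrices of `φ : 𝔞 → 𝔞′`, `ψ : 𝔞′ → 𝔞` with `ψφ = N`, `φψ = N`, as for an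
inclusion of lattices `𝔞 ⊂ 𝔟` with `N𝔟 ⊂ 𝔞`.  Then `(A ⊗ P)(A ⊗ Q) = ι(N) = [N]` and `(A ⊗ Q)(A ⊗ P) = [N]` (FILE 13), so by FILE 14
the homomorphism `A ⊗ P : A ⊗_𝒪 𝔞 → A ⊗_𝒪 𝔞′` is fibrewise an isogeny, finite, flat and surjective with finite locally free kernel
(B. Conrad, *Gross–Zagier revisited* §7, Thm. 7.5 and its proof: `M ⊗_𝒪 A → N ⊗_𝒪 A` is an isogeny for `M ↪ N` of finite index).

## Contents

* `RingAction.i_natCast : act.i (N : O) = (𝟙 A.X) ^ N`;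
* `serrePresentationHom_comp_eq_pow_of_quasiInverse` (`(A ⊗ P) ≫ (A ⊗ Q) = (𝟙 _) ^ N`);
* **`isIsogeny_fibreHom_serrePresentationHom`**, **`isFinite_serrePresentationHom_left`**, **`flat_serrePresentationHom_left`**,
  **`surjective_serrePresentationHom_left`**, `isFinite_fst_unit_serrePresentationHom`, `flat_fst_unit_serrePresentationHom`;
* `serrePresentationHom_presMatrix_isogeny` — the same for actual module maps `φ`, `ψ` with `ψ ∘ φ = N • id`, `φ ∘ ψ = N • id`.

## References
* [Conrad2004GrossZagier] B. Conrad, *Gross–Zagier revisited*, MSRI Publ. 49 (2004), §7 (Thm. 7.5).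
* [GortzWedhorn2023] U. Görtz, T. Wedhorn, *Algebraic Geometry II* (2023), Def. 27.176, Cor. 27.177 (1).
-/

noncomputable section

universe u

open CategoryTheory CategoryTheory.Limits AlgebraicGeometry MonoidalCategory CartesianMonoidalCategory
open scoped MonObj

namespace Literature.AlgebraicGeometry.AbelianSchemes

namespace AbelianSchemeOver

open Literature.Algebra.Module.IdempotentMatrix
open Literature.AlgebraicGeometry.Motives (AbelianVariety)

variable {S : Scheme.{u}} {A : AbelianSchemeOver S} {O : Type*} [CommRing O] (act : A.RingAction O)

/-- `ι(N) = [N]` for a natural number `N`. [cite: Kottwitz1992, §5 (p. 390)] -/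
theorem RingAction.i_natCast (N : ℕ) : act.i (N : O) = (𝟙 A.X : A.X ⟶ A.X) ^ N := by
  rw [← Nat.smul_one_eq_cast, act.i_nsmul, act.i_one]

variable [IsCommMonObj A.X] {m n : ℕ} (E : Matrix (Fin n) (Fin n) O) (hE : E * E = E) (E' : Matrix (Fin m) (Fin m) O)
  (hE' : E' * E' = E') (P : Matrix (Fin m) (Fin n) O) (Q : Matrix (Fin n) (Fin m) O) {N : ℕ}

/-- `(A ⊗ P) ≫ (A ⊗ Q) = [N]` when `QP = N·E`. [cite: Conrad2004GrossZagier, §7] -/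
theorem serrePresentationHom_comp_eq_pow_of_quasiInverse (hP : E' * P = P * E) (hQ : E * Q = Q * E')
    (hQP : Q * P = Matrix.scalar (Fin n) (N : O) * E) :
    serrePresentationHom act E hE E' hE' P ≫ serrePresentationHom act E' hE' E hE Q = (𝟙 (serreTensor act E hE).X) ^ N := by
  rw [serrePresentationHom_comp_of_quasiInverse act E hE E' hE' P Q hP hQ hQP, RingAction.i_natCast]

/-- **Every fibre of `A ⊗ P` is an isogeny** (quasi-inverse presentations up to `N ≠ 0`). [cite: Conrad2004GrossZagier, §7] -/
theorem isIsogeny_fibreHom_serrePresentationHom (hN : N ≠ 0) (hP : E' * P = P * E) (hQ : E * Q = Q * E')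
    (hQP : Q * P = Matrix.scalar (Fin n) (N : O) * E) (hPQ : P * Q = Matrix.scalar (Fin m) (N : O) * E')
    {Ω : Type u} [Field Ω] (t : Spec (.of Ω) ⟶ S) :
    haveI := isMonHom_serrePresentationHom act E hE E' hE' P
    AbelianVariety.IsIsogeny (fibreHom (A := serreTensor act E hE) (B := serreTensor act E' hE') (serrePresentationHom act E hE E' hE' P) t) :=
  haveI := isMonHom_serrePresentationHom act E hE E' hE' P
  isIsogeny_fibreHom_of_quasiInverse (A := serreTensor act E hE) (B := serreTensor act E' hE') _ (serrePresentationHom act E' hE' E hE Q) hN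
    (serrePresentationHom_comp_eq_pow_of_quasiInverse act E hE E' hE' P Q hP hQ hQP)
    (serrePresentationHom_comp_eq_pow_of_quasiInverse act E' hE' E hE Q P hQ hP hPQ) t

/-- **`A ⊗ P` is FINITE.** [cite: Conrad2004GrossZagier, §7] -/
theorem isFinite_serrePresentationHom_left (hN : N ≠ 0) (hP : E' * P = P * E) (hQ : E * Q = Q * E')
    (hQP : Q * P = Matrix.scalar (Fin n) (N : O) * E) (hPQ : P * Q = Matrix.scalar (Fin m) (N : O) * E') :
    IsFinite (serrePresentationHom act E hE E' hE' P).left :=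
  haveI := isMonHom_serrePresentationHom act E hE E' hE' P
  isFinite_left_of_quasiInverse (A := serreTensor act E hE) (B := serreTensor act E' hE') _ (serrePresentationHom act E' hE' E hE Q) hN
    (serrePresentationHom_comp_eq_pow_of_quasiInverse act E hE E' hE' P Q hP hQ hQP)
    (serrePresentationHom_comp_eq_pow_of_quasiInverse act E' hE' E hE Q P hQ hP hPQ)

/-- **`A ⊗ P` is FLAT.** [cite: Conrad2004GrossZagier, §7] -/
theorem flat_serrePresentationHom_left (hN : N ≠ 0) (hP : E' * P = P * E) (hQ : E * Q = Q * E')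
    (hQP : Q * P = Matrix.scalar (Fin n) (N : O) * E) (hPQ : P * Q = Matrix.scalar (Fin m) (N : O) * E') :
    Flat (serrePresentationHom act E hE E' hE' P).left :=
  haveI := isMonHom_serrePresentationHom act E hE E' hE' P
  flat_left_of_quasiInverse (A := serreTensor act E hE) (B := serreTensor act E' hE') _ (serrePresentationHom act E' hE' E hE Q) hN
    (serrePresentationHom_comp_eq_pow_of_quasiInverse act E hE E' hE' P Q hP hQ hQP)
    (serrePresentationHom_comp_eq_pow_of_quasiInverse act E' hE' E hE Q P hQ hP hPQ)

/-- **`A ⊗ P` is SURJECTIVE.** [cite: Conrad2004GrossZagier, §7] -/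
theorem surjective_serrePresentationHom_left (hN : N ≠ 0) (hP : E' * P = P * E) (hQ : E * Q = Q * E')
    (hQP : Q * P = Matrix.scalar (Fin n) (N : O) * E) (hPQ : P * Q = Matrix.scalar (Fin m) (N : O) * E') :
    Surjective (serrePresentationHom act E hE E' hE' P).left :=
  haveI := isMonHom_serrePresentationHom act E hE E' hE' P
  surjective_left_of_quasiInverse (A := serreTensor act E hE) (B := serreTensor act E' hE') _ (serrePresentationHom act E' hE' E hE Q)
    hN (serrePresentationHom_comp_eq_pow_of_quasiInverse act E hE E' hE' P Q hP hQ hQP)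
    (serrePresentationHom_comp_eq_pow_of_quasiInverse act E' hE' E hE Q P hQ hP hPQ)

/-- **`Ker (A ⊗ P) → S` is FINITE.** [cite: Conrad2004GrossZagier, §7] -/
theorem isFinite_fst_unit_serrePresentationHom (hN : N ≠ 0) (hP : E' * P = P * E) (hQ : E * Q = Q * E')
    (hQP : Q * P = Matrix.scalar (Fin n) (N : O) * E) (hPQ : P * Q = Matrix.scalar (Fin m) (N : O) * E') :
    IsFinite (pullback.fst (η[(serreTensor act E' hE').X] : 𝟙_ (Over S) ⟶ (serreTensor act E' hE').X).left
      (serrePresentationHom act E hE E' hE' P).left) :=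
  haveI := isMonHom_serrePresentationHom act E hE E' hE' P
  isFinite_fst_unit_of_quasiInverse (A := serreTensor act E hE) (B := serreTensor act E' hE') _ (serrePresentationHom act E' hE' E hE Q)
    hN (serrePresentationHom_comp_eq_pow_of_quasiInverse act E hE E' hE' P Q hP hQ hQP)
    (serrePresentationHom_comp_eq_pow_of_quasiInverse act E' hE' E hE Q P hQ hP hPQ)

/-- **`Ker (A ⊗ P) → S` is FLAT** (finite locally free). [cite: Conrad2004GrossZagier, §7] -/
theorem flat_fst_unit_serrePresentationHom (hN : N ≠ 0) (hP : E' * P = P * E) (hQ : E * Q = Q * E')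
    (hQP : Q * P = Matrix.scalar (Fin n) (N : O) * E) (hPQ : P * Q = Matrix.scalar (Fin m) (N : O) * E') :
    Flat (pullback.fst (η[(serreTensor act E' hE').X] : 𝟙_ (Over S) ⟶ (serreTensor act E' hE').X).left
      (serrePresentationHom act E hE E' hE' P).left) :=
  haveI := isMonHom_serrePresentationHom act E hE E' hE' P
  flat_fst_unit_of_quasiInverse (A := serreTensor act E hE) (B := serreTensor act E' hE') _ (serrePresentationHom act E' hE' E hE Q)
    hN (serrePresentationHom_comp_eq_pow_of_quasiInverse act E hE E' hE' P Q hP hQ hQP)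
    (serrePresentationHom_comp_eq_pow_of_quasiInverse act E' hE' E hE Q P hQ hP hPQ)

/-- **For actual module maps**: `φ : 𝔞 → 𝔞′`, `ψ : 𝔞′ → 𝔞` with `ψ ∘ φ = N • id`, `φ ∘ ψ = N • id`, `N ≠ 0` ⇒ `A ⊗ φ` (the Serre map of
`P(φ) = presMatrix E E' φ`) is finite, flat and surjective. [cite: Conrad2004GrossZagier, §7] -/
theorem serrePresentationHom_presMatrix_isogeny (hN : N ≠ 0)
    (φ : LinearMap.range (Matrix.toLin' E) →ₗ[O] LinearMap.range (Matrix.toLin' E'))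
    (ψ : LinearMap.range (Matrix.toLin' E') →ₗ[O] LinearMap.range (Matrix.toLin' E))
    (hψφ : ψ ∘ₗ φ = (N : O) • LinearMap.id) (hφψ : φ ∘ₗ ψ = (N : O) • LinearMap.id) :
    IsFinite (serrePresentationHom act E hE E' hE' (presMatrix E E' φ)).left ∧
      Flat (serrePresentationHom act E hE E' hE' (presMatrix E E' φ)).left ∧
        Surjective (serrePresentationHom act E hE E' hE' (presMatrix E E' φ)).left := by
  have hQP : presMatrix E' E ψ * presMatrix E E' φ = Matrix.scalar (Fin n) (N : O) * E := by
    rw [presMatrix_comp_of_smul_id E E' hE' φ ψ hψφ, smul_eq_scalar_mul]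
  have hPQ : presMatrix E E' φ * presMatrix E' E ψ = Matrix.scalar (Fin m) (N : O) * E' := by
    rw [presMatrix_comp_of_smul_id E' E hE ψ φ hφψ, smul_eq_scalar_mul]
  exact ⟨isFinite_serrePresentationHom_left act E hE E' hE' _ _ hN (presMatrix_intertwines φ hE hE') (presMatrix_intertwines ψ hE' hE)
      hQP hPQ,
    flat_serrePresentationHom_left act E hE E' hE' _ _ hN (presMatrix_intertwines φ hE hE') (presMatrix_intertwines ψ hE' hE) hQP hPQ,
    surjective_serrePresentationHom_left act E hE E' hE' _ _ hN (presMatrix_intertwines φ hE hE') (presMatrix_intertwines ψ hE' hE)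
      hQP hPQ⟩

end AbelianSchemeOver

end Literature.AlgebraicGeometry.AbelianSchemes

end
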